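import Summits.BirchSwinnertonDyer.BirchSwinnertonDyer.Theorems.ByReductionTypeAtTwoTowerLayerLocal
import HarnessLib

/-!
# The TOWER door's GAP certificate read off two finite layers with EXPLICIT local error terms, and the
# doors with BOTH certificates from finite layers (route ByReductionTypeAtTwo, crux `OrdKatoHalfAtTwo`,
# item stmt-BirchSwinnertonDyer-19271; seat bsd-2adic-tower-1, D-0074 (T1), part 3b)

HONEST FRAMING (cell `bsd-2adic`, run/shared/lean/pub/bsd-2adic/, HUMAN RULINGS D-0036/D-0074): THEOREMS
ONLY; nothing asserted; no definition; no new named fact; closes nothing by itself. `p = 2`, `W/ℚ`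
globally minimal elliptic with ODD torsion order (`E(ℚ)[2] = 0`; automatic for `E[2]` irreducible).

* `towerGapAtTwo_of_layerClasses` (kernel form): certificates `2^a ≤ #Sel_{2^∞}(E/ℚ_j)[2]` and
  `#A_{j'}[2] ≤ 2^b` (`A_{j'} = h_{j'}⁻¹(Sel_∞) ⊆ H¹(ℚ_{j'}, E[2^∞])`), `j ≤ j'`, `b < 2^{j'} − 2^j + a`
  ⇒ `O1.TowerGapAtTwo W` (with `m = 2^j`, `k = 2^{j'} − 2^j`: `#X/(2,T^{2^{j'}})X = #A_{j'}[2]`, part 2, and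
  `2^a ≤ #X/(2,T^{2^j})X`, part 1).
* `towerGapAtTwo_of_localKernelBounds` (local form): the upper datum is `#Sel_{2^∞}(E/ℚ_{j'})[2] ≤ 2^d`
  plus, at level `j'` for every cyclotomic `κ`, the LOCAL KERNEL HYPOTHESES `𝒦_{v,j'}[2^∞] = 0` off a
  finite set `S` (`h0`), `#𝒦_{v,j'}[2] ≤ C_v` on `S` (`hC`), covering sets of size `≤ N_v` (`hN`;
  `N_v = 1` at `v = 2` by `TowerLayer.cover_singleton_at_p`, `≤ 2^{j'}` always by
  `TowerLayer.exists_cover_of_layerSubgroup`), and the arithmetic `2^d · ∏_{v∈S} C_v^{N_v} < 2^{2^{j'}−2^j+a}`.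
* the DOORS of `…TowerLayerRank.lean` with `hgap` DISCHARGED this way:
  `bsdp_two_of_layerSelmer_of_localKernelBounds` (rank `0`: PRINT {modularity, GZK, Kato 17.4 (1)(2)@2,
  Greenberg Thm. 4.1@2, Prop. 4.14@2} + certificates {`hper₀`, `μ_an = 0`, `λ_an = n`, three layer
  Selmer counts, covers, arithmetic} + level-`j'` local kernel hypotheses ⇒ `BSDp W 2`),
  `mazurMainConjecture_two_of_layerSelmer_of_localKernelBounds`, `katoHalfAt_two_…` (the item AT `W`).

What the local kernel hypotheses ARE in print (NOT asserted here): Greenberg LNM 1716 Lemma 3.3 (good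
`v ∤ 2`: `𝒦 = 0`; bad `v ∤ 2`: `#𝒦[2^∞] = c_{v}^{(2)}` over the layer), Lemma 3.4 (`v = 2`, good ordinary:
`#𝒦[2^∞] = |Ẽ(𝔽₂)(2)|²`, i.e. `4` if `a₂ = 1`, `16` if `a₂ = −1`).

References: R. Greenberg, LNM 1716 (1999), §1 p. 60, §3 pp. 85–90, Thm. 4.1, Prop. 4.14; K. Kato,
Astérisque 295 (2004), Thm. 17.4; L. Washington, *Introduction to Cyclotomic Fields*, §13.2.
-/

set_option autoImplicit false

noncomputable section

open scoped Classical MatrixGroups ModularForm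

open NumberField IsDedekindDomain CongruenceSubgroup WeierstrassCurve Literature.NumberTheory.EllipticCurves
  Literature.NumberTheory.EllipticCurves.ModularForms Literature.NumberTheory.EllipticCurves.Rank1Residual
  Literature.NumberTheory.EllipticCurves.Rank1Residual.Typed
  Literature.NumberTheory.EllipticCurves.Greenberg1999
  Summit.BirchSwinnertonDyer.Rank1Residual.X1.MuLambda
  Summit.BirchSwinnertonDyer.Rank1Residual.X1.MuPart
  Summit.BirchSwinnertonDyer.Rank1Residual.X1.ParitySqueeze
  Summit.BirchSwinnertonDyer.BirchSwinnertonDyer.Theorems.Rank1ResidualX1Defs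
  Summit.BirchSwinnertonDyer.Rank1Residual.X5 Summit.BirchSwinnertonDyer.Rank1Residual.X5.O1
  Summit.BirchSwinnertonDyer.Rank1Residual.X5.TowerGap
  Summit.BirchSwinnertonDyer.Rank1Residual

/-! ## §3 `p = 2` over `ℚ`: the GAP bridges and the doors with both certificates from finite layers -/

namespace Summit.BirchSwinnertonDyer.BirchSwinnertonDyer.Theorems.KatoHalfPinch

section Curve

variable (W : WeierstrassCurve ℚ) [W.IsElliptic] [W.IsGloballyMinimal]

omit [W.IsGloballyMinimal] in
/-- **The GAP certificate from two layers (kernel form).** `W/ℚ` with odd torsion order; layers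
`j ≤ j'`; a LOWER certificate `2^a ≤ #Sel_{2^∞}(E/ℚ_j)[2]` and an UPPER bound `#A_{j'}[2] ≤ 2^b` on the
`2`-torsion of `A_{j'} = h_{j'}⁻¹(Sel_∞) ⊆ H¹(ℚ_{j'}, E[2^∞])`, for every cyclotomic `κ`, with
`b < 2^{j'} − 2^j + a`. Then `O1.TowerGapAtTwo W` (with `m = 2^j`, `k = 2^{j'} − 2^j`):
`#X/(2,T^{2^{j'}})X = #A_{j'}[2] ≤ 2^b < 2^k · 2^a ≤ 2^k · #X/(2,T^{2^j})X`.
[cite: GreenbergLNM1716, §1 p. 60 and §3 pp. 85–90] [cite: Washington1997, §13.2] -/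
theorem towerGapAtTwo_of_layerClasses (htors : ¬ 2 ∣ W.torsionOrder) {j j' a b : ℕ} (hjj' : j ≤ j')
    (hlow : ∀ κ : ZpExtension ℚ 2, κ.IsCyclotomic →
      2 ^ a ≤ Nat.card {z : W.selmerLayer κ j // 2 • z = 0})
    (hup : ∀ κ : ZpExtension ℚ 2, κ.IsCyclotomic →
      Nat.card {z : W.selmerInftyPreimage κ j' // 2 • z = 0} ≤ 2 ^ b)
    (hab : b < 2 ^ j' - 2 ^ j + a) : TowerGapAtTwo W := by
  intro κ γ hκ hγ _ D
  haveI : Module.Finite (IwasawaAlgebra 2) D.X := D.module_finite_holds hγ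
  have hK := Iwasawa.forall_smul_eq_zero_imp_of_not_dvd_torsionOrder W htors
  have hpow : 2 ^ j ≤ 2 ^ j' := Nat.pow_le_pow_right (by norm_num) hjj'
  refine ⟨2 ^ j, 2 ^ j' - 2 ^ j, ?_⟩
  rw [Nat.add_sub_cancel' hpow,
    TowerLayer.natCard_quotient_towerIdeal_eq_natCard_layerClasses W κ D hγ hK j']
  calc Nat.card {z : W.selmerInftyPreimage κ j' // 2 • z = 0}
      ≤ 2 ^ b := hup κ hκ
    _ < 2 ^ (2 ^ j' - 2 ^ j + a) := Nat.pow_lt_pow_right (by norm_num) hab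
    _ = 2 ^ (2 ^ j' - 2 ^ j) * 2 ^ a := by rw [pow_add]
    _ ≤ 2 ^ (2 ^ j' - 2 ^ j) *
        Nat.card (D.X ⧸ (towerIdeal 2 (2 ^ j) • ⊤ : Submodule (IwasawaAlgebra 2) D.X)) :=
      Nat.mul_le_mul_left _
        ((hlow κ hκ).trans (finite_and_natCard_selmerLayer_pTorsion_le W κ D hK j).2)

omit [W.IsGloballyMinimal] in
/-- **The GAP certificate from two layers with EXPLICIT local error terms.** `W/ℚ` with odd torsion
order; layers `j ≤ j'`; certificates `2^a ≤ #Sel_{2^∞}(E/ℚ_j)[2]` and `#Sel_{2^∞}(E/ℚ_{j'})[2] ≤ 2^d`; a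
finite set `S` of primes with, at level `j'` and for every cyclotomic `κ`: `𝒦_{v,j'}[2^∞] = 0` off `S`
(`h0`), `#𝒦_{v,j'}[2] ≤ C_v` on `S` (`hC`), covering sets of size `≤ N_v` (`hN`; `N_v = 1` at `v = 2`
by `TowerLayer.cover_singleton_at_p`, `≤ 2^{j'}` always by `TowerLayer.exists_cover_of_layerSubgroup`);
and the arithmetic `2^d · ∏_{v ∈ S} C_v^{N_v} < 2^{2^{j'} − 2^j + a}`. Then `O1.TowerGapAtTwo W`.
[cite: GreenbergLNM1716, §3 pp. 85–90 (Lemmas 3.3–3.5)] [cite: Washington1997, §13.2] -/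
theorem towerGapAtTwo_of_localKernelBounds (htors : ¬ 2 ∣ W.torsionOrder) {j j' a d : ℕ}
    (hjj' : j ≤ j') (S : Finset (HeightOneSpectrum (𝓞 ℚ))) (C N : HeightOneSpectrum (𝓞 ℚ) → ℕ)
    (hlow : ∀ κ : ZpExtension ℚ 2, κ.IsCyclotomic →
      2 ^ a ≤ Nat.card {z : W.selmerLayer κ j // 2 • z = 0})
    (hup : ∀ κ : ZpExtension ℚ 2, κ.IsCyclotomic →
      Nat.card {z : W.selmerLayer κ j' // 2 • z = 0} ≤ 2 ^ d)
    (h0 : ∀ κ : ZpExtension ℚ 2, κ.IsCyclotomic →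
      ∀ v ∉ S, W.localTowerKerPrimary κ (v.adicCompletion ℚ) j' = ⊥)
    (hC : ∀ κ : ZpExtension ℚ 2, κ.IsCyclotomic → ∀ v ∈ S,
      Finite {x : W.localTowerKerPrimary κ (v.adicCompletion ℚ) j' // 2 • x = 0} ∧
        Nat.card {x : W.localTowerKerPrimary κ (v.adicCompletion ℚ) j' // 2 • x = 0} ≤ C v)
    (hN : ∀ κ : ZpExtension ℚ 2, κ.IsCyclotomic → ∀ v ∈ S,
      ∃ R : Finset (Field.absoluteGaloisGroup ℚ), R.card ≤ N v ∧
        ∀ σ : Field.absoluteGaloisGroup ℚ, ∃ ρ ∈ R,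
          ∃ δ : Field.absoluteGaloisGroup (v.adicCompletion ℚ), ∃ τ ∈ κ.layerSubgroup j',
            σ = resGal (K := ℚ) (v.adicCompletion ℚ) δ * ρ * τ)
    (harith : 2 ^ d * ∏ v ∈ S, C v ^ N v < 2 ^ (2 ^ j' - 2 ^ j + a)) : TowerGapAtTwo W := by
  intro κ γ hκ hγ _ D
  haveI : Module.Finite (IwasawaAlgebra 2) D.X := D.module_finite_holds hγ
  have hK := Iwasawa.forall_smul_eq_zero_imp_of_not_dvd_torsionOrder W htors
  have hpow : 2 ^ j ≤ 2 ^ j' := Nat.pow_le_pow_right (by norm_num) hjj'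
  choose! R hRcard hRcov using hN κ hκ
  -- `1 ≤ C v` on `S` (the `2`-torsion of `𝒦_{v,j'}` contains `0`)
  have hCpos : ∀ v ∈ S, 1 ≤ C v := fun v hv ↦ by
    haveI := (hC κ hκ v hv).1
    haveI : Nonempty {x : W.localTowerKerPrimary κ (v.adicCompletion ℚ) j' // 2 • x = 0} :=
      ⟨⟨0, smul_zero _⟩⟩
    exact Nat.succ_le_of_lt (lt_of_lt_of_le Nat.card_pos (hC κ hκ v hv).2)
  refine ⟨2 ^ j, 2 ^ j' - 2 ^ j, ?_⟩
  rw [Nat.add_sub_cancel' hpow]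
  calc Nat.card (D.X ⧸ (towerIdeal 2 (2 ^ j') • ⊤ : Submodule (IwasawaAlgebra 2) D.X))
      ≤ Nat.card {z : W.selmerLayer κ j' // 2 • z = 0} * ∏ v ∈ S, C v ^ (R v).card :=
        TowerLayer.natCard_quotient_towerIdeal_le_of_localKernelBounds W κ D hγ hK S C R (h0 κ hκ)
          (hC κ hκ) hRcov
    _ ≤ 2 ^ d * ∏ v ∈ S, C v ^ N v :=
        Nat.mul_le_mul (hup κ hκ) (Finset.prod_le_prod (fun v _ ↦ Nat.zero_le _)
          fun v hv ↦ Nat.pow_le_pow_right (hCpos v hv) (hRcard v hv))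
    _ < 2 ^ (2 ^ j' - 2 ^ j + a) := harith
    _ = 2 ^ (2 ^ j' - 2 ^ j) * 2 ^ a := by rw [pow_add]
    _ ≤ 2 ^ (2 ^ j' - 2 ^ j) *
        Nat.card (D.X ⧸ (towerIdeal 2 (2 ^ j) • ⊤ : Submodule (IwasawaAlgebra 2) D.X)) :=
      Nat.mul_le_mul_left _
        ((hlow κ hκ).trans (finite_and_natCard_selmerLayer_pTorsion_le W κ D hK j).2)

/-- **Door (TOWER, both certificates from finite layers) for `BSD(E,2)` at analytic rank `0`** on a
good-ordinary-at-`2` curve with odd torsion order: PRINT {modularity, GZK, Kato 17.4 (1)(2)@2, Greenberg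
Thm. 4.1@2 (`hEC`), Prop. 4.14@2 (`h414`)} + certificates {`hper₀`, `μ_an = 0`, `λ_an = n`,
`2^n ≤ #Sel_{2^∞}(E/ℚ_{j₀})[2]` (rank), `2^a ≤ #Sel_{2^∞}(E/ℚ_j)[2]`, `#Sel_{2^∞}(E/ℚ_{j'})[2] ≤ 2^d`,
covers `N_v`, arithmetic} + the level-`j'` LOCAL KERNEL hypotheses {`h0`, `hC`} (Greenberg Lemmas
3.3/3.4 — NOT asserted here) ⇒ `BSDp W 2`. [cite: GreenbergLNM1716, Thm. 4.1, Prop. 4.14, §3 Lemmas 3.3–3.5]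
[cite: Kato2004Asterisque, Thm. 17.4 (1)(2) (p. 273)] [cite: Miller2011LMS, Def. 1.1] -/
theorem bsdp_two_of_layerSelmer_of_localKernelBounds (hmod : nonempty_modularParametrizationData)
    (hGZK : rank_eq_analyticRank_of_analyticRank_le_one)
    (h17 : ∀ [NeZero (W.conductorNorm ℤ)] (f : CuspForm (Gamma0 (W.conductorNorm ℤ)) 2),
      kato_divisibility_allPrimes W 2 (f := f))
    (hEC : TwoAdicEulerCharRankZero W 0) (h414 : prop414_noFiniteSubmodule_of_not_dvd_torsionOrder)
    (hper₀ : ∀ [NeZero (W.conductorNorm ℤ)] (f : CuspForm (Gamma0 (W.conductorNorm ℤ)) 2),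
      IsNewformOf W f → ∀ ϖ : ℚ, (ϖ : ℝ) * W.realPeriodRat = plusPeriod f → 0 ≤ padicValRat 2 ϖ)
    (hgo : GoodOrd W 2) (hr : W.analyticRank = 0) (htors : ¬ 2 ∣ W.torsionOrder) {n j₀ j j' a d : ℕ}
    (hrank : ∀ κ : ZpExtension ℚ 2, κ.IsCyclotomic →
      2 ^ n ≤ Nat.card {z : W.selmerLayer κ j₀ // 2 • z = 0})
    (hjj' : j ≤ j') (S : Finset (HeightOneSpectrum (𝓞 ℚ))) (C N : HeightOneSpectrum (𝓞 ℚ) → ℕ)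
    (hlow : ∀ κ : ZpExtension ℚ 2, κ.IsCyclotomic →
      2 ^ a ≤ Nat.card {z : W.selmerLayer κ j // 2 • z = 0})
    (hup : ∀ κ : ZpExtension ℚ 2, κ.IsCyclotomic →
      Nat.card {z : W.selmerLayer κ j' // 2 • z = 0} ≤ 2 ^ d)
    (h0 : ∀ κ : ZpExtension ℚ 2, κ.IsCyclotomic →
      ∀ v ∉ S, W.localTowerKerPrimary κ (v.adicCompletion ℚ) j' = ⊥)
    (hC : ∀ κ : ZpExtension ℚ 2, κ.IsCyclotomic → ∀ v ∈ S,
      Finite {x : W.localTowerKerPrimary κ (v.adicCompletion ℚ) j' // 2 • x = 0} ∧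
        Nat.card {x : W.localTowerKerPrimary κ (v.adicCompletion ℚ) j' // 2 • x = 0} ≤ C v)
    (hN : ∀ κ : ZpExtension ℚ 2, κ.IsCyclotomic → ∀ v ∈ S,
      ∃ R : Finset (Field.absoluteGaloisGroup ℚ), R.card ≤ N v ∧
        ∀ σ : Field.absoluteGaloisGroup ℚ, ∃ ρ ∈ R,
          ∃ δ : Field.absoluteGaloisGroup (v.adicCompletion ℚ), ∃ τ ∈ κ.layerSubgroup j',
            σ = resGal (K := ℚ) (v.adicCompletion ℚ) δ * ρ * τ)
    (harith : 2 ^ d * ∏ v ∈ S, C v ^ N v < 2 ^ (2 ^ j' - 2 ^ j + a))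
    (hlan : AnalyticLambdaEq W 2 n) (hμan : AnalyticMuLE W 2 0) : BSDp W 2 :=
  bsdp_two_of_towerGap_of_layerSelmer W hmod hGZK h17 hEC h414 hper₀ hgo hr htors
    (towerGapAtTwo_of_localKernelBounds W htors hjj' S C N hlow hup h0 hC hN harith) hrank hlan hμan

/-- **Door (TOWER, both certificates from finite layers): `MazurMainConjecture W 2`** — any analytic
rank, any residual image, odd torsion order; PRINT {Kato 17.4 (1)(2)@2, Greenberg Prop. 4.14@2} +
layer certificates + level-`j'` local kernel hypotheses. [cite: Kato2004Asterisque, Thm. 17.4 (1)(2) (p. 273)]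
[cite: GreenbergLNM1716, Prop. 4.14, §3 Lemmas 3.3–3.5] [cite: GreenbergVatsal2000, p. 4 (after Thm. (1.2))] -/
theorem mazurMainConjecture_two_of_layerSelmer_of_localKernelBounds
    (h17 : ∀ [NeZero (W.conductorNorm ℤ)] (f : CuspForm (Gamma0 (W.conductorNorm ℤ)) 2),
      kato_divisibility_allPrimes W 2 (f := f))
    (h414 : prop414_noFiniteSubmodule_of_not_dvd_torsionOrder)
    (hper₀ : ∀ [NeZero (W.conductorNorm ℤ)] (f : CuspForm (Gamma0 (W.conductorNorm ℤ)) 2),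
      IsNewformOf W f → ∀ ϖ : ℚ, (ϖ : ℝ) * W.realPeriodRat = plusPeriod f → 0 ≤ padicValRat 2 ϖ)
    (hgo : GoodOrd W 2) (htors : ¬ 2 ∣ W.torsionOrder) {n j₀ j j' a d : ℕ}
    (hrank : ∀ κ : ZpExtension ℚ 2, κ.IsCyclotomic →
      2 ^ n ≤ Nat.card {z : W.selmerLayer κ j₀ // 2 • z = 0})
    (hjj' : j ≤ j') (S : Finset (HeightOneSpectrum (𝓞 ℚ))) (C N : HeightOneSpectrum (𝓞 ℚ) → ℕ)
    (hlow : ∀ κ : ZpExtension ℚ 2, κ.IsCyclotomic →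
      2 ^ a ≤ Nat.card {z : W.selmerLayer κ j // 2 • z = 0})
    (hup : ∀ κ : ZpExtension ℚ 2, κ.IsCyclotomic →
      Nat.card {z : W.selmerLayer κ j' // 2 • z = 0} ≤ 2 ^ d)
    (h0 : ∀ κ : ZpExtension ℚ 2, κ.IsCyclotomic →
      ∀ v ∉ S, W.localTowerKerPrimary κ (v.adicCompletion ℚ) j' = ⊥)
    (hC : ∀ κ : ZpExtension ℚ 2, κ.IsCyclotomic → ∀ v ∈ S,
      Finite {x : W.localTowerKerPrimary κ (v.adicCompletion ℚ) j' // 2 • x = 0} ∧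
        Nat.card {x : W.localTowerKerPrimary κ (v.adicCompletion ℚ) j' // 2 • x = 0} ≤ C v)
    (hN : ∀ κ : ZpExtension ℚ 2, κ.IsCyclotomic → ∀ v ∈ S,
      ∃ R : Finset (Field.absoluteGaloisGroup ℚ), R.card ≤ N v ∧
        ∀ σ : Field.absoluteGaloisGroup ℚ, ∃ ρ ∈ R,
          ∃ δ : Field.absoluteGaloisGroup (v.adicCompletion ℚ), ∃ τ ∈ κ.layerSubgroup j',
            σ = resGal (K := ℚ) (v.adicCompletion ℚ) δ * ρ * τ)
    (harith : 2 ^ d * ∏ v ∈ S, C v ^ N v < 2 ^ (2 ^ j' - 2 ^ j + a))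
    (hlan : AnalyticLambdaEq W 2 n) (hμan : AnalyticMuLE W 2 0) : MazurMainConjecture W 2 :=
  mazurMainConjecture_two_of_towerGap_of_layerSelmer W h17 h414 hper₀ hgo htors
    (towerGapAtTwo_of_localKernelBounds W htors hjj' S C N hlow hup h0 hC hN harith) hrank hlan hμan

/-- **The Kato–Néron half (the item `OrdKatoHalfAtTwo` AT `W`), both certificates from finite layers.**
[cite: Kato2004Asterisque, Thm. 17.4 (1)(2) (p. 273)] [cite: GreenbergLNM1716, Prop. 4.14, §3 Lemmas 3.3–3.5] -/
theorem katoHalfAt_two_of_layerSelmer_of_localKernelBounds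
    (h17 : ∀ [NeZero (W.conductorNorm ℤ)] (f : CuspForm (Gamma0 (W.conductorNorm ℤ)) 2),
      kato_divisibility_allPrimes W 2 (f := f))
    (h414 : prop414_noFiniteSubmodule_of_not_dvd_torsionOrder)
    (hper₀ : ∀ [NeZero (W.conductorNorm ℤ)] (f : CuspForm (Gamma0 (W.conductorNorm ℤ)) 2),
      IsNewformOf W f → ∀ ϖ : ℚ, (ϖ : ℝ) * W.realPeriodRat = plusPeriod f → 0 ≤ padicValRat 2 ϖ)
    (hgo : GoodOrd W 2) (htors : ¬ 2 ∣ W.torsionOrder) {n j₀ j j' a d : ℕ}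
    (hrank : ∀ κ : ZpExtension ℚ 2, κ.IsCyclotomic →
      2 ^ n ≤ Nat.card {z : W.selmerLayer κ j₀ // 2 • z = 0})
    (hjj' : j ≤ j') (S : Finset (HeightOneSpectrum (𝓞 ℚ))) (C N : HeightOneSpectrum (𝓞 ℚ) → ℕ)
    (hlow : ∀ κ : ZpExtension ℚ 2, κ.IsCyclotomic →
      2 ^ a ≤ Nat.card {z : W.selmerLayer κ j // 2 • z = 0})
    (hup : ∀ κ : ZpExtension ℚ 2, κ.IsCyclotomic →
      Nat.card {z : W.selmerLayer κ j' // 2 • z = 0} ≤ 2 ^ d)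
    (h0 : ∀ κ : ZpExtension ℚ 2, κ.IsCyclotomic →
      ∀ v ∉ S, W.localTowerKerPrimary κ (v.adicCompletion ℚ) j' = ⊥)
    (hC : ∀ κ : ZpExtension ℚ 2, κ.IsCyclotomic → ∀ v ∈ S,
      Finite {x : W.localTowerKerPrimary κ (v.adicCompletion ℚ) j' // 2 • x = 0} ∧
        Nat.card {x : W.localTowerKerPrimary κ (v.adicCompletion ℚ) j' // 2 • x = 0} ≤ C v)
    (hN : ∀ κ : ZpExtension ℚ 2, κ.IsCyclotomic → ∀ v ∈ S,
      ∃ R : Finset (Field.absoluteGaloisGroup ℚ), R.card ≤ N v ∧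
        ∀ σ : Field.absoluteGaloisGroup ℚ, ∃ ρ ∈ R,
          ∃ δ : Field.absoluteGaloisGroup (v.adicCompletion ℚ), ∃ τ ∈ κ.layerSubgroup j',
            σ = resGal (K := ℚ) (v.adicCompletion ℚ) δ * ρ * τ)
    (harith : 2 ^ d * ∏ v ∈ S, C v ^ N v < 2 ^ (2 ^ j' - 2 ^ j + a))
    (hlan : AnalyticLambdaEq W 2 n) (hμan : AnalyticMuLE W 2 0) :
    MainConjectureLowerDivisibilityAtTwoOrd W :=
  katoHalfAt_two_of_towerGap_of_layerSelmer W h17 h414 hper₀ hgo htors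
    (towerGapAtTwo_of_localKernelBounds W htors hjj' S C N hlow hup h0 hC hN harith) hrank hlan hμan

end Curve

end Summit.BirchSwinnertonDyer.BirchSwinnertonDyer.Theorems.KatoHalfPinch

end
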